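import Mathlib
import HarnessLib
import Literature.Analysis.FluidPDE.Tao2016AveragedNS.RestartedCascadeFlows

/-!
# `CompletionRelayChain` — crux `RelayFrontStep` (item stmt-NavierStokesRegularity-24850):
  ENERGY INCREMENTS of a pseudo-flow on sub-intervals (helper for LINE `window_v2`, stubs `stub_wake`,
  `stub_front`)

The tree's energy cap (`GappedFrontRobust.pseudoFlowOn_energy_cap`, re-derived inside
`…TailEnergy.pseudoFlowOn_block_energy_le`) integrates the one-sided energy inequality (4.9),
`∂ₛF_{i,k} ≤ quadTerm(S)_{i,k}·S_{i,k}`, from time `0`. The one-sided family bootstrap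
(`RelayFrontStep.bootstrap_family_oneSided[_slack]`) needs the same on every SUB-interval
`[s, t] ⊆ [0, τ]`: `F_{i,k}(t) − F_{i,k}(s) ≤ ∫ₛᵗ quadTerm(S)_{i,k}(u)·S_{i,k}(u) du`
(`pseudoFlowOn_energy_increment_le`), and, for a uniform growth constant, the crude form
`F_{i,k}(t) − F_{i,k}(s) ≤ C·(t − s)` whenever the integrand is `≤ C` on `[s, t]`
(`pseudoFlowOn_energy_increment_le_const`). Generic in the table, the scale ratio and the defect
constants.

No definitions. HONEST FRAMING: elementary calculus of MODEL lattice pseudo-flows (Tao 2016 §4 (4.9));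
helper for the crux, no stub credit; nothing here is a statement about the Navier–Stokes equations.
-/

noncomputable section

-- the summit-side namespace `Summit.NavierStokesRegularity.NavierStokesRegularity.…` (single-conjunct summit,
-- D-0017) repeats a component by design; the dupNamespace linter would flag every declaration.
set_option linter.dupNamespace false

open Set MeasureTheory intervalIntegral Literature.Analysis.FluidPDE Literature.Analysis.FluidPDE.TaoCascade

namespace Summit.NavierStokesRegularity.NavierStokesRegularity.Theorems

namespace RelayFrontStep

variable {m : ℕ} {τ ε₀ κ₁ κ₂ : ℝ} {α : Fin m → Fin m → Fin m → ℤ × ℤ × ℤ → ℝ}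
  {S₀ F₀ B₀ : Fin m → ℤ → ℝ} {S F : Fin m → ℤ → ℝ → ℝ}

/-- Along a pseudo-flow the products `u ↦ quadTerm(S)_{i,k}(u)·S_{i,k}(u)` are continuous on `[0, τ]`.
[cite: Tao2016AveragedNS, §4 Lemma 4.1 (4.5), (4.8)] -/
theorem pseudoFlowOn_continuousOn_quadTerm_mul (h : PseudoFlowOn τ ε₀ α κ₁ κ₂ S₀ F₀ B₀ S F)
    (i : Fin m) (k : ℤ) :
    ContinuousOn (fun u => quadTerm ε₀ α S i k u * S i k u) (Icc 0 τ) := by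
  have hS : ∀ i n, ContinuousOn (S i n) (Icc 0 τ) := fun i n => (h.contDiffOn_S i n).continuousOn
  have hq : ContinuousOn (fun t => quadTerm ε₀ α S i k t) (Icc 0 τ) := by
    unfold quadTerm
    refine continuousOn_finsetSum _ fun i₁ _ => continuousOn_finsetSum _ fun i₂ _ =>
      continuousOn_finsetSum _ fun μ _ => ?_
    exact continuousOn_const.mul ((hS _ _).mul (hS _ _))
  exact hq.mul (hS i k)

/-- **Energy increment on a sub-interval** ((4.9) has no defect term): along every pseudo-flow on
`[0, τ]` (`τ > 0`), for every mode, shell and `0 ≤ s ≤ t ≤ τ`,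
`F_{i,k}(t) − F_{i,k}(s) ≤ ∫ₛᵗ quadTerm(S)_{i,k}(u)·S_{i,k}(u) du`.
[cite: Tao2016AveragedNS, §4 Lemma 4.1 (4.9)] -/
theorem pseudoFlowOn_energy_increment_le (h : PseudoFlowOn τ ε₀ α κ₁ κ₂ S₀ F₀ B₀ S F) (hτ : 0 < τ)
    (i : Fin m) (k : ℤ) {s t : ℝ} (hs : 0 ≤ s) (hst : s ≤ t) (ht : t ≤ τ) :
    F i k t - F i k s ≤ ∫ u in s..t, quadTerm ε₀ α S i k u * S i k u := by
  have hsubI : Icc s t ⊆ Icc 0 τ := Icc_subset_Icc hs ht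
  have hsub : uIcc s t ⊆ Icc 0 τ := by rwa [uIcc_of_le hst]
  have hf := h.contDiffOn_F i k
  have hcont : ContinuousOn (F i k) (Icc s t) := hf.continuousOn.mono hsubI
  have hf'cont : ContinuousOn (derivWithin (F i k) (Icc 0 τ)) (Icc 0 τ) :=
    hf.continuousOn_derivWithin (uniqueDiffOn_Icc hτ) le_rfl
  have hderiv : ∀ x ∈ Ioo s t, HasDerivAt (F i k) (derivWithin (F i k) (Icc 0 τ) x) x := by
    intro x hx
    have hx0 : 0 < x := lt_of_le_of_lt hs hx.1
    have hxτ : x < τ := lt_of_lt_of_le hx.2 ht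
    have hxI : Icc 0 τ ∈ nhds x := Icc_mem_nhds hx0 hxτ
    have hd : DifferentiableWithinAt ℝ (F i k) (Icc 0 τ) x :=
      (hf.differentiableOn one_ne_zero) x ⟨hx0.le, hxτ.le⟩
    rw [derivWithin_of_mem_nhds hxI]
    exact (hd.differentiableAt hxI).hasDerivAt
  have hint' : IntervalIntegrable (derivWithin (F i k) (Icc 0 τ)) volume s t :=
    (hf'cont.mono hsub).intervalIntegrable
  have hint : IntervalIntegrable (fun u => quadTerm ε₀ α S i k u * S i k u) volume s t :=
    ((pseudoFlowOn_continuousOn_quadTerm_mul h i k).mono hsub).intervalIntegrable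
  have hftc := intervalIntegral.integral_eq_sub_of_hasDerivAt_of_le hst hcont hderiv hint'
  have hmono := intervalIntegral.integral_mono_on hst hint' hint
    fun u hu => h.energy i k u (hsubI hu)
  rw [hftc] at hmono
  exact hmono

/-- **Uniform energy growth on a sub-interval**: if `quadTerm(S)_{i,k}·S_{i,k} ≤ C` on `[s, t] ⊆ [0, τ]`,
then `F_{i,k}(t) − F_{i,k}(s) ≤ C·(t − s)` — the one-sided growth hypothesis of
`RelayFrontStep.bootstrap_family_oneSided`. [cite: Tao2016AveragedNS, §4 Lemma 4.1 (4.9)] -/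
theorem pseudoFlowOn_energy_increment_le_const (h : PseudoFlowOn τ ε₀ α κ₁ κ₂ S₀ F₀ B₀ S F)
    (hτ : 0 < τ) (i : Fin m) (k : ℤ) {s t C : ℝ} (hs : 0 ≤ s) (hst : s ≤ t) (ht : t ≤ τ)
    (hC : ∀ u ∈ Icc s t, quadTerm ε₀ α S i k u * S i k u ≤ C) :
    F i k t - F i k s ≤ C * (t - s) := by
  have hsub : uIcc s t ⊆ Icc 0 τ := by rw [uIcc_of_le hst]; exact Icc_subset_Icc hs ht
  have hint : IntervalIntegrable (fun u => quadTerm ε₀ α S i k u * S i k u) volume s t :=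
    ((pseudoFlowOn_continuousOn_quadTerm_mul h i k).mono hsub).intervalIntegrable
  have h1 := pseudoFlowOn_energy_increment_le h hτ i k hs hst ht
  have h2 : (∫ u in s..t, quadTerm ε₀ α S i k u * S i k u) ≤ ∫ u in s..t, C :=
    intervalIntegral.integral_mono_on hst hint (by simp) fun u hu => hC u hu
  rw [intervalIntegral.integral_const, smul_eq_mul] at h2
  linarith

end RelayFrontStep

end Summit.NavierStokesRegularity.NavierStokesRegularity.Theorems
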